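import Mathlib
import HarnessLib
import Literature.Analysis.FluidPDE.SelfSimilar
import Literature.Analysis.FluidPDE.VectorCalculus
import Literature.Analysis.FluidPDE.Vorticity
import Summits.NavierStokesRegularity.NavierStokesRegularity.Theses.ThreadingFlux
import Summits.NavierStokesRegularity.NavierStokesRegularity.Theses.UnthreadedDoor
import Summits.NavierStokesRegularity.NavierStokesRegularity.Theorems.UnthreadedDoorVorticityOfClass
import Summits.NavierStokesRegularity.NavierStokesRegularity.Theorems.UnthreadedDoorToroidalPotential
import Summits.NavierStokesRegularity.NavierStokesRegularity.Theorems.UnthreadedDoorPotentialEvolution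
import Summits.NavierStokesRegularity.NavierStokesRegularity.Theorems.UnthreadedDoorConstantOfIrrotational

/-!
# Route `UnthreadedDoor` / `ThreadingFlux`, crux `PoloidalLiouville` (stmt-NavierStokesRegularity-1222): the antidynamo v2
# composition `PoloidalLiouville_of`, kernel-checked in the tree — the crux decl BY NAME from the single open stub, the wall
# `StubScalarLiouville` (2b)

Support file (seat leafhand-ns-unthreadeddoor-1 g0, cell decomp-ns), `--supports stmt-NavierStokesRegularity-1222`.  The registered
skeleton `PoloidalLiouville_antidynamo_birth_v2.lean` (planner ns-idea-6 g5, sha16 `4ebf5683127b`) composes the crux from five stubs: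
bridge `stub_vorticityOfClass`, (2a) `stub_toroidalPotential`, (2a-evo) `stub_potentialEvolution`, (2b) `stub_scalarLiouville` and stub 3
`stub_constantOfIrrotational`.  Four of the five are theorems of the tree (`UnthreadedDoorVorticityOfClass.lean`,
`UnthreadedDoorToroidalPotential.lean`, `UnthreadedDoorPotentialEvolution.lean`, `UnthreadedDoorConstantOfIrrotational.lean`, namespace
`…Theorems.PoloidalLiouville`).  This file twins the remaining stub Prop `StubScalarLiouville` VERBATIM (skeleton l. 112) and runs the
skeleton's composition against the tree proofs, so that the crux is CLOSED MODULO THE WALL inside the tree, for both token-identical route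
decls:

* ★ `poloidalLiouville_of_stubScalarLiouville  : StubScalarLiouville → Theses.ThreadingFlux.PoloidalLiouville`
* ★ `poloidalLiouville_of_stubScalarLiouville' : StubScalarLiouville → Theses.UnthreadedDoor.PoloidalLiouville`

THE WALL (what `StubScalarLiouville` says): a bounded ancient duality-class solution, jointly smooth, whose vorticity is `∇T × (x − x₀)`
for a bounded potential `T` (smooth off the centre) obeying the exact law (E1) `∇(∂ₜT + ⟪v,∇T⟫ − ΔT) × (x − x₀) = ∇⟪v, x − x₀⟫ × ∇T`, has
`∇T × (x − x₀) ≡ 0`.  In print this is OPEN beyond axisymmetry (the zonal sub-case is KNSS 2009 Thm 5.2, tree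
`Literature.Analysis.FluidPDE.knss_axisymmetric_no_swirl'_holds`).

HONEST LABEL: a CONDITIONAL reduction (hypothesis = the research stub); no new mathematics beyond wiring; `StubScalarLiouville`,
`PoloidalLiouville` (1222), the two routes' Targets and NS regularity remain OPEN; nothing here bears on the summit.
-/

noncomputable section

-- the summit and its single sub-problem share the name (CONVENTIONS §1)
set_option linter.dupNamespace false

open scoped BigOperators Topology MeasureTheory InnerProductSpace RealInnerProductSpace
open Filter Set Function MeasureTheory

namespace Summit.NavierStokesRegularity.NavierStokesRegularity.Theorems.PoloidalLiouville.Antidynamo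

/-- STUB (2b) statement of the antidynamo v2 skeleton (planner ns-idea-6 g5) — twin, body VERBATIM (skeleton l. 112): SCALAR LIOUVILLE for
the toroidal potential — THE WALL of the line (XL, research; open in print beyond axisymmetry).  A bounded ancient duality-class solution,
jointly smooth, whose vorticity is `∇T × (x − x₀)` for a bounded potential `T` obeying the evolution law (E1), has `∇T × (x − x₀) ≡ 0`. -/
def StubScalarLiouville : Prop :=
  ∀ (v : ℝ → EuclideanSpace ℝ (Fin 3) → EuclideanSpace ℝ (Fin 3)) (x₀ : EuclideanSpace ℝ (Fin 3))
    (T : ℝ → EuclideanSpace ℝ (Fin 3) → ℝ),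
    Literature.Analysis.FluidPDE.IsBoundedAncientMildSolution 1 v →
    (∀ t < 0, AEStronglyMeasurable (v t) volume) →
    ContDiffOn ℝ (⊤ : ℕ∞) (Function.uncurry v) (Set.Iio 0 ×ˢ Set.univ) →
    ContDiffOn ℝ (⊤ : ℕ∞) (Function.uncurry T) (Set.Iio 0 ×ˢ ({x₀}ᶜ : Set (EuclideanSpace ℝ (Fin 3)))) →
    (∃ C : ℝ, ∀ t < 0, ∀ x, |T t x| ≤ C) →
    (∀ t < 0, ∀ x, Literature.Analysis.FluidPDE.curl (v t) x =
      Literature.Analysis.FluidPDE.cross (gradient (T t) x) (x - x₀)) →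
    (∀ t < 0, ∀ x, x ≠ x₀ →
      Literature.Analysis.FluidPDE.cross
          (gradient (fun z => deriv (fun s => T s z) t + inner ℝ (v t z) (gradient (T t) z)
            - Laplacian.laplacian (T t) z) x) (x - x₀) =
        Literature.Analysis.FluidPDE.cross (gradient (fun z => inner ℝ (v t z) (z - x₀)) x) (gradient (T t) x)) →
    ∀ t < 0, ∀ x, Literature.Analysis.FluidPDE.cross (gradient (T t) x) (x - x₀) = 0

/-- ★ **The antidynamo composition, kernel-checked: `StubScalarLiouville → PoloidalLiouville` (route `ThreadingFlux` decl, BY NAME).**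
Given the wall, a smooth member `v` of the duality class unthreaded about `x₀` has constant slices: the bridge gives the vorticity
formulation and a vorticity bound `K` (`PoloidalLiouville.stub_vorticityOfClass`); the Mie representation gives a bounded potential `T`,
smooth off the centre, with `curl v = ∇T × (x − x₀)` (`PoloidalLiouville.stub_toroidalPotential`); the potential obeys (E1)
(`PoloidalLiouville.stub_potentialEvolution`); the wall gives `∇T × (x − x₀) ≡ 0`, i.e. `curl v ≡ 0`; and curl-free slices of the class
are constant (`PoloidalLiouville.stub_constantOfIrrotational`).  This is the skeleton's `PoloidalLiouville_of` with its four proved stubs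
inlined; conditional on `StubScalarLiouville` only. -/
theorem poloidalLiouville_of_stubScalarLiouville (hW : StubScalarLiouville) :
    Summit.NavierStokesRegularity.NavierStokesRegularity.Theses.ThreadingFlux.PoloidalLiouville := by
  intro v hB hm hsm hx t ht
  obtain ⟨x₀, hx₀⟩ := hx
  obtain ⟨hV, K, hK⟩ :=
    _root_.Summit.NavierStokesRegularity.NavierStokesRegularity.Theorems.PoloidalLiouville.stub_vorticityOfClass v hB hm hsm
  obtain ⟨T, hT, hTb, hrep⟩ :=
    _root_.Summit.NavierStokesRegularity.NavierStokesRegularity.Theorems.PoloidalLiouville.stub_toroidalPotential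
      v x₀ K hsm hK hx₀
  have hE :=
    _root_.Summit.NavierStokesRegularity.NavierStokesRegularity.Theorems.PoloidalLiouville.stub_potentialEvolution
      v x₀ T hV hT hrep
  have h0 := hW v x₀ T hB hm hsm hT ⟨Real.pi * K, hTb⟩ hrep hE
  have hcurl : ∀ s < 0, ∀ x, Literature.Analysis.FluidPDE.curl (v s) x = 0 := fun s hs x => by
    rw [hrep s hs x]
    exact h0 s hs x
  exact _root_.Summit.NavierStokesRegularity.NavierStokesRegularity.Theorems.PoloidalLiouville.stub_constantOfIrrotational
    v hB hsm hcurl t ht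

/-- ★ The same composition for the token-identical crux decl of route `UnthreadedDoor`:
`StubScalarLiouville → Theses.UnthreadedDoor.PoloidalLiouville`. -/
theorem poloidalLiouville_of_stubScalarLiouville' (hW : StubScalarLiouville) :
    Summit.NavierStokesRegularity.NavierStokesRegularity.Theses.UnthreadedDoor.PoloidalLiouville :=
  poloidalLiouville_of_stubScalarLiouville hW

end Summit.NavierStokesRegularity.NavierStokesRegularity.Theorems.PoloidalLiouville.Antidynamo

end
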